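import Summits.AtomisticToContinuum.Crystallization.Theorems.StackingHinge.Negative.ScaleSelection

/-!
# `StackingHinge` (stmt-AtomisticToContinuum-14993), negative side II: periodic charge forces
# recurrence of a lattice basis; kill criteria

Negative lemmas of the standing disprover of the crux `StackingHinge`
(`= SoftLayerPropagation → ChargeFreeWindows → GroundStatesChargePeriodic`, route PricedLinkCensus),
extracted from `Cruxes/StackingHinge/Disproof.lean` §3a and landed through the registered stub
`stub_basisRecurrent` of line `Sketch`; no positive route statement is concluded.  Part I
(`Negative/ScaleSelection.lean`) supplies `ChargesPeriodic`, `groundStatesChargePeriodic_iff` and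
`not_stackingHinge_iff`.

* §3a WORD SELECTION IS LOAD-BEARING — the necessary condition.  The consequent `ChargesPeriodic x`
  (some periodic `Q` is charged with positive upper density at every window `(R, ε)`) has a `Q`-free
  NECESSARY condition: ONE basis `b` of `ℝ³` (a `ℤ`-basis of the period lattice of `Q`) recurs, up
  to a site-dependent linear isometry `A`, as a triple of approximate periods of the `R`-window of a
  positive upper density of sites, at every `(R, ε)` (`stub_basisRecurrent`, the registered form
  with `ChargesPeriodic` unfolded; `exists_basis_recurrent_of_chargesPeriodic`; read on the
  consequent of the crux: `recurrent_of_groundStatesChargePeriodic`).  Proof: with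
  `M = ∑ₖ ‖b k‖`, a site that is good for `Q` at the window `(R + M + ε, ε/2)` is recurrent at
  `(R, ε)` — a site `x N j` of the `R`-window is `ε/2`-close to `x N i + A (s - q)` for some
  `s ∈ Q.points` with `dist s q ≤ R + ε/2`, the point `s + b k ∈ Q.points` lies within `R + M + ε`
  of `q`, hence is `ε/2`-close to some site `x N j'`, and `dist (x N j') (x N j + A (b k)) ≤ ε`.
  The density `ρ` and the infinitely many `N` are inherited.
* KILL CRITERIA (contrapositives).  A sequence along which, at SOME window `(R, ε)`, every basis of
  `ℝ³` fails to recur on a positive upper density of sites charges no periodic configuration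
  (`not_chargesPeriodic_of_not_recurrent`); ONE such sequence of Lennard-Jones ground states refutes
  the shared hinge 2911 (`not_groundStatesChargePeriodic_of_not_recurrent`) and, granted the two
  antecedents `SoftLayerPropagation` and `ZeroChargeBulk` (`↔ ChargeFreeWindows`), the crux
  (`stackingHinge_false_of_not_recurrent`, through `not_stackingHinge_iff`).

All `[folklore]`.
-/

noncomputable section

namespace Summit.AtomisticToContinuum.Crystallization.Theorems.StackingHingeNegative

open Summit.AtomisticToContinuum.Crystallization.Theses.PricedLinkCensus
open Summit.AtomisticToContinuum.Crystallization.Theorems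
open Filter Topology
open Literature.MathematicalPhysics.StatisticalMechanics
open Literature.Geometry.DiscreteGeometry

/-! ## §3a Periodic charge forces recurrence of a lattice basis -/

/-- **Periodic charge forces recurrence of a lattice basis** (registered stub `stub_basisRecurrent`
of line `Sketch`; the hypothesis is `ChargesPeriodic x` unfolded).  If some periodic `Q` is charged
along `x` with positive upper density at every window, let `b` be an `ℝ`-basis of `ℝ³` consisting of
periods of `Q` (a `ℤ`-basis of `Q.lattice`) and `M = ∑ₖ ‖b k‖`.  A site that is good for `Q` at the
window `(R + M + ε, ε/2)` is recurrent at `(R, ε)`: a site `x N j` of the `R`-window is `ε/2`-close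
to `x N i + A (s - q)` for some `s ∈ Q.points` with `dist s q ≤ R + ε/2`, the point
`s + b k ∈ Q.points` is within `R + M + ε` of `q`, hence `ε/2`-close to some site `x N j'`, and then
`dist (x N j') (x N j + A (b k)) ≤ ε`.  The density `ρ` and the infinitely many `N` are inherited.
[folklore] -/
theorem stub_basisRecurrent : ∀ x : (N : ℕ) → (Fin N → EuclideanSpace ℝ (Fin 3)), (∃ Q : Literature.MathematicalPhysics.StatisticalMechanics.PeriodicConfiguration 3, ∀ R ε : ℝ, 0 < R → 0 < ε → ∃ ρ : ℝ, 0 < ρ ∧ ∃ᶠ N : ℕ in Filter.atTop, ρ * (N : ℝ) ≤ (Nat.card {i : Fin N // ∃ A : EuclideanSpace ℝ (Fin 3) →ₗᵢ[ℝ] EuclideanSpace ℝ (Fin 3), ∃ q ∈ Q.points, (∀ s ∈ Q.points, dist s q ≤ R → ∃ j : Fin N, dist (x N j) (x N i + A (s - q)) ≤ ε) ∧ (∀ j : Fin N, dist (x N j) (x N i) ≤ R → ∃ s ∈ Q.points, dist (x N j) (x N i + A (s - q)) ≤ ε)} : ℝ)) → ∃ (ι : Type) (b : Module.Basis ι ℝ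 (EuclideanSpace ℝ (Fin 3))), ∀ R ε : ℝ, 0 < R → 0 < ε → ∃ ρ : ℝ, 0 < ρ ∧ ∃ᶠ N : ℕ in Filter.atTop, ρ * (N : ℝ) ≤ (Nat.card {i : Fin N // ∃ A : EuclideanSpace ℝ (Fin 3) →ₗᵢ[ℝ] EuclideanSpace ℝ (Fin 3), ∀ (k : ι) (j : Fin N), dist (x N j) (x N i) ≤ R → ∃ j' : Fin N, dist (x N j') (x N j + A (b k)) ≤ ε} : ℝ) := by
  -- adapted from `Cruxes/StackingHinge/Disproof.lean` §3a
  -- (`exists_basis_recurrent_of_chargesPeriodic`, standing disprover, cycle 1)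
  intro x hx
  obtain ⟨Q, hQ⟩ := hx
  classical
  refine ⟨Module.Free.ChooseBasisIndex ℤ Q.lattice,
    (Module.Free.chooseBasis ℤ Q.lattice).ofZLatticeBasis ℝ Q.lattice, ?_⟩
  set b := (Module.Free.chooseBasis ℤ Q.lattice).ofZLatticeBasis ℝ Q.lattice with hbdef
  have hb : ∀ k, b k ∈ Q.lattice := fun k => by
    rw [hbdef, Module.Basis.ofZLatticeBasis_apply]
    exact (Module.Free.chooseBasis ℤ Q.lattice k).2
  set M : ℝ := ∑ k, ‖b k‖ with hM
  have hMk : ∀ k, ‖b k‖ ≤ M := fun k =>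
    Finset.single_le_sum (f := fun k => ‖b k‖) (fun k _ => norm_nonneg _) (Finset.mem_univ k)
  have hM0 : 0 ≤ M := Finset.sum_nonneg fun k _ => norm_nonneg _
  intro R ε hR hε
  obtain ⟨ρ, hρ, hfr⟩ := hQ (R + M + ε) (ε / 2) (by linarith) (half_pos hε)
  refine ⟨ρ, hρ, hfr.mono fun N hN => hN.trans ?_⟩
  have key : ∀ i : Fin N,
      (∃ A : EuclideanSpace ℝ (Fin 3) →ₗᵢ[ℝ] EuclideanSpace ℝ (Fin 3), ∃ q ∈ Q.points,
        (∀ s ∈ Q.points, dist s q ≤ R + M + ε →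
          ∃ j : Fin N, dist (x N j) (x N i + A (s - q)) ≤ ε / 2) ∧
        (∀ j : Fin N, dist (x N j) (x N i) ≤ R + M + ε →
          ∃ s ∈ Q.points, dist (x N j) (x N i + A (s - q)) ≤ ε / 2)) →
      ∃ A : EuclideanSpace ℝ (Fin 3) →ₗᵢ[ℝ] EuclideanSpace ℝ (Fin 3), ∀ (k) (j : Fin N),
        dist (x N j) (x N i) ≤ R → ∃ j' : Fin N, dist (x N j') (x N j + A (b k)) ≤ ε := by
    rintro i ⟨A, q, hq, h1, h2⟩
    refine ⟨A, fun k j hj => ?_⟩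
    obtain ⟨s, hs, hjs⟩ := h2 j (by linarith)
    have hsq : dist s q ≤ R + ε / 2 := by
      have : dist s q = dist (x N i + A (s - q)) (x N i) := by
        rw [dist_eq_norm, dist_eq_norm, add_sub_cancel_left, LinearIsometry.norm_map]
      rw [this]
      calc dist (x N i + A (s - q)) (x N i)
          ≤ dist (x N i + A (s - q)) (x N j) + dist (x N j) (x N i) := dist_triangle _ _ _
        _ ≤ ε / 2 + R := add_le_add (by rwa [dist_comm]) hj
        _ = R + ε / 2 := by ring
    obtain ⟨j', hj'⟩ := h1 (s + b k) (Q.add_mem_points hs (hb k)) (by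
      calc dist (s + b k) q ≤ dist (s + b k) s + dist s q := dist_triangle _ _ _
        _ = ‖b k‖ + dist s q := by rw [dist_eq_norm, add_sub_cancel_left]
        _ ≤ M + (R + ε / 2) := add_le_add (hMk k) hsq
        _ ≤ R + M + ε := by linarith)
    refine ⟨j', ?_⟩
    have hsplit : x N i + A (s + b k - q) = (x N i + A (s - q)) + A (b k) := by
      rw [show s + b k - q = (s - q) + b k by abel, map_add, add_assoc]
    calc dist (x N j') (x N j + A (b k))
        ≤ dist (x N j') (x N i + A (s + b k - q)) +
            dist (x N i + A (s + b k - q)) (x N j + A (b k)) := dist_triangle _ _ _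
      _ ≤ ε / 2 + ε / 2 := add_le_add hj' (by rw [hsplit, dist_add_right, dist_comm]; exact hjs)
      _ = ε := by ring
  exact_mod_cast Nat.card_le_card_of_injective (Subtype.map id fun i hi => key i hi)
    (Subtype.map_injective _ Function.injective_id)

/-- **Periodic charge forces recurrence of a lattice basis.**  If `ChargesPeriodic x` (witness `Q`),
let `b` be an `ℝ`-basis of `ℝ³` consisting of periods of `Q` and `M = ∑ₖ ‖b k‖`.  A site that is
good for `Q` at the window `(R + M + ε, ε/2)` is recurrent at `(R, ε)`: a site `x N j` of the
`R`-window is `ε/2`-close to `x N i + A (s - q)` for some `s ∈ Q.points` with `dist s q ≤ R + ε/2`,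
the point `s + b k ∈ Q.points` is within `R + M + ε` of `q`, hence `ε/2`-close to some site
`x N j'`, and then `dist (x N j') (x N j + A (b k)) ≤ ε`.  The density `ρ` and the infinitely many
`N` are inherited.  (This is `stub_basisRecurrent` read on the predicate `ChargesPeriodic` of
`Negative/ScaleSelection.lean`, which unfolds to the stub's hypothesis.) [folklore] -/
theorem exists_basis_recurrent_of_chargesPeriodic
    {x : (N : ℕ) → (Fin N → EuclideanSpace ℝ (Fin 3))} (hx : ChargesPeriodic x) :
    ∃ (ι : Type) (b : Module.Basis ι ℝ (EuclideanSpace ℝ (Fin 3))), ∀ R ε : ℝ, 0 < R → 0 < ε →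
      ∃ ρ : ℝ, 0 < ρ ∧ ∃ᶠ N : ℕ in atTop, ρ * (N : ℝ) ≤ (Nat.card {i : Fin N //
        ∃ A : EuclideanSpace ℝ (Fin 3) →ₗᵢ[ℝ] EuclideanSpace ℝ (Fin 3), ∀ (k : ι) (j : Fin N),
          dist (x N j) (x N i) ≤ R → ∃ j' : Fin N, dist (x N j') (x N j + A (b k)) ≤ ε} : ℝ) :=
  stub_basisRecurrent x hx

/-- The same read on `GroundStatesChargePeriodic` (the consequent of the crux): along every sequence
of Lennard-Jones ground states some basis of `ℝ³` recurs, up to site-dependent rotations, with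
positive upper density at every window.  A sequence of ground states violating this recurrence — a
positive density of windows, at some fixed `(R, ε)`, admitting NO triple of independent approximate
periods from a fixed basis — refutes 2911 and with it (given the two antecedents) the crux.
[folklore] -/
theorem recurrent_of_groundStatesChargePeriodic
    (h : Summit.AtomisticToContinuum.Crystallization.Theses.PricedLinkCensus.GroundStatesChargePeriodic)
    (x : (N : ℕ) → (Fin N → EuclideanSpace ℝ (Fin 3)))
    (hx : ∀ N, IsGroundState lennardJones (x N)) :
    ∃ (ι : Type) (b : Module.Basis ι ℝ (EuclideanSpace ℝ (Fin 3))), ∀ R ε : ℝ, 0 < R → 0 < ε →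
      ∃ ρ : ℝ, 0 < ρ ∧ ∃ᶠ N : ℕ in atTop, ρ * (N : ℝ) ≤ (Nat.card {i : Fin N //
        ∃ A : EuclideanSpace ℝ (Fin 3) →ₗᵢ[ℝ] EuclideanSpace ℝ (Fin 3), ∀ (k : ι) (j : Fin N),
          dist (x N j) (x N i) ≤ R → ∃ j' : Fin N, dist (x N j') (x N j + A (b k)) ≤ ε} : ℝ) :=
  exists_basis_recurrent_of_chargesPeriodic (groundStatesChargePeriodic_iff.1 h x hx)

/-! ## Kill criteria (contrapositives) -/

/-- **Kill criterion (contrapositive).**  A sequence along which, for SOME window `(R, ε)`, every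
basis of `ℝ³` fails to recur (up to rotations) on a positive upper density of sites charges no
periodic configuration. [folklore] -/
theorem not_chargesPeriodic_of_not_recurrent
    {x : (N : ℕ) → (Fin N → EuclideanSpace ℝ (Fin 3))}
    (h : ∀ (ι : Type) (b : Module.Basis ι ℝ (EuclideanSpace ℝ (Fin 3))), ∃ R ε : ℝ, 0 < R ∧ 0 < ε ∧
      ∀ ρ : ℝ, 0 < ρ → ∀ᶠ N : ℕ in atTop, (Nat.card {i : Fin N //
        ∃ A : EuclideanSpace ℝ (Fin 3) →ₗᵢ[ℝ] EuclideanSpace ℝ (Fin 3), ∀ (k : ι) (j : Fin N),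
          dist (x N j) (x N i) ≤ R → ∃ j' : Fin N, dist (x N j') (x N j + A (b k)) ≤ ε} : ℝ) <
        ρ * (N : ℝ)) :
    ¬ ChargesPeriodic x := by
  intro hx
  obtain ⟨ι, b, hb⟩ := exists_basis_recurrent_of_chargesPeriodic hx
  obtain ⟨R, ε, hR, hε, hfail⟩ := h ι b
  obtain ⟨ρ, hρ, hfr⟩ := hb R ε hR hε
  exact (hfr.and_eventually (hfail ρ hρ)).exists.elim fun N hN => absurd hN.1 (not_le.2 hN.2)

/-- **Kill criterion for the shared hinge 2911** (and hence, given the two antecedents, for the crux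
`StackingHinge`, by `not_stackingHinge_iff`): ONE sequence of Lennard-Jones ground states without
basis recurrence at some window refutes `GroundStatesChargePeriodic`. [folklore] -/
theorem not_groundStatesChargePeriodic_of_not_recurrent
    (x : (N : ℕ) → (Fin N → EuclideanSpace ℝ (Fin 3)))
    (hx : ∀ N, IsGroundState lennardJones (x N))
    (h : ∀ (ι : Type) (b : Module.Basis ι ℝ (EuclideanSpace ℝ (Fin 3))), ∃ R ε : ℝ, 0 < R ∧ 0 < ε ∧
      ∀ ρ : ℝ, 0 < ρ → ∀ᶠ N : ℕ in atTop, (Nat.card {i : Fin N //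
        ∃ A : EuclideanSpace ℝ (Fin 3) →ₗᵢ[ℝ] EuclideanSpace ℝ (Fin 3), ∀ (k : ι) (j : Fin N),
          dist (x N j) (x N i) ≤ R → ∃ j' : Fin N, dist (x N j') (x N j + A (b k)) ≤ ε} : ℝ) <
        ρ * (N : ℝ)) :
    ¬ Summit.AtomisticToContinuum.Crystallization.Theses.PricedLinkCensus.GroundStatesChargePeriodic :=
  fun hG => not_chargesPeriodic_of_not_recurrent h (groundStatesChargePeriodic_iff.1 hG x hx)

/-- The same kill criterion read on the crux: given its two antecedents (`SoftLayerPropagation` and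
`ZeroChargeBulk ↔ ChargeFreeWindows`), a non-recurrent sequence of ground states refutes
`StackingHinge`. [folklore] -/
theorem stackingHinge_false_of_not_recurrent
    (hSLP : Summit.AtomisticToContinuum.Crystallization.Theses.PricedLinkCensus.SoftLayerPropagation)
    (hZ : Summit.AtomisticToContinuum.Crystallization.Theses.PricedLinkCensus.ZeroChargeBulk)
    (x : (N : ℕ) → (Fin N → EuclideanSpace ℝ (Fin 3)))
    (hx : ∀ N, IsGroundState lennardJones (x N))
    (h : ∀ (ι : Type) (b : Module.Basis ι ℝ (EuclideanSpace ℝ (Fin 3))), ∃ R ε : ℝ, 0 < R ∧ 0 < ε ∧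
      ∀ ρ : ℝ, 0 < ρ → ∀ᶠ N : ℕ in atTop, (Nat.card {i : Fin N //
        ∃ A : EuclideanSpace ℝ (Fin 3) →ₗᵢ[ℝ] EuclideanSpace ℝ (Fin 3), ∀ (k : ι) (j : Fin N),
          dist (x N j) (x N i) ≤ R → ∃ j' : Fin N, dist (x N j') (x N j + A (b k)) ≤ ε} : ℝ) <
        ρ * (N : ℝ)) :
    ¬ Summit.AtomisticToContinuum.Crystallization.Theses.PricedLinkCensus.StackingHinge :=
  not_stackingHinge_iff.2 ⟨hSLP, hZ, not_groundStatesChargePeriodic_of_not_recurrent x hx h⟩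

end Summit.AtomisticToContinuum.Crystallization.Theorems.StackingHingeNegative

end
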